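import Literature.NumberTheory.Automorphic.GodementJacquetContinuation
import Literature.NumberTheory.Automorphic.SatakeParameterBoundHolds
import HarnessLib

/-!
# lang.S21: `godementJacquet_hasMeromorphicContinuation` holds (discharge)

Topic `NumberTheory/Automorphic`; namespace `Literature.NumberTheory.Automorphic`. Proof file
(theorems only: no definition, no named fact).

The named fact `Literature.NumberTheory.Automorphic.godementJacquet_hasMeromorphicContinuation` of
`AutomorphicLFunctions` (**lang.S21**: for every cuspidal automorphic representation `Π` of
`GL_n(𝔸_K)` some standard L-function datum `D` — the true Godement–Jacquet factors — has `D.L`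
meromorphic on `ℂ`; Godement–Jacquet, LNM 260 (1972), Thm. 13.8; Jacquet–Shalika, Amer. J. Math.
103 (1981), Thm. (5.3)) was reduced in `GodementJacquetContinuation` to two named inputs
(`godementJacquet_hasMeromorphicContinuation_of_gjZeta_meromorphic_of_summable`):

1. `GodementJacquet1972_gjZeta_meromorphic` — the global theory of the zeta integrals
   `Z(Φ, s, φ, φ')` of Schwartz–Bruhat functions against `K`-finite cuspidal coefficients
   (LNM 260, §§11–13), and
2. `summable_normSq_trace_satakePow` — Jacquet–Shalika's (5.3.3)–(5.3.4), holomorphy of `L^S` on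
   `re s > 1`.

Both are meanwhile theorems of the tree: `GodementJacquet1972_gjZeta_meromorphic_holds`
(`GodementJacquetZetaIntegralsProofs`: Tate for `n = 1`, Poisson summation, the reflection of the
truncated integral and the vanishing of the singular defect on cusp forms for `n ≥ 2`) and
`summable_normSq_trace_satakePow_holds` (`SatakeParameterBoundHolds`: the unfolded Rankin–Selberg
torus integral). This file composes them: `godementJacquet_hasMeromorphicContinuation_holds`, and
with it the partial-L-function form `partialStandardL_hasMeromorphicContinuation_holds` and
Thm. 13.8(2) for `L^S`, `GodementJacquet1972_meromorphic_partialStandardL_holds`. No new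
definitions, no new named facts; net debt `-3`.

## References

* R. Godement, H. Jacquet, *Zeta functions of simple algebras*, LNM 260 (1972), Thm. 13.8 with
  §§11–13 [GodementJacquet1972].
* H. Jacquet, J. A. Shalika, *On Euler products and the classification of automorphic
  representations I*, Amer. J. Math. 103 (1981), Thm. (5.3) [JacquetShalikaAJM1981].
-/

noncomputable section

open NumberField IsDedekindDomain MeasureTheory

namespace Literature.NumberTheory.Automorphic

variable {n : ℕ} {K : Type} [Field K] [NumberField K]
  {μ : Measure (AdelicGroupData.gl n K).automorphicQuotient}
  [(AdelicGroupData.gl n K).IsAutomorphicMeasure μ]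

/-- **Godement–Jacquet, Thm. 13.8(2) for `L^S` (right-half-plane form) holds**: for every cuspidal
`Π` on `GL_n(𝔸_K)`, every finite `S` containing the ramified places and every honest Satake family
`α` off `S`, some function meromorphic on `ℂ` agrees with `L^S(s, Π)` on a right half-plane — the
named fact `GodementJacquet1972_meromorphic_partialStandardL` of `GodementJacquetPartialL`, from the
global theory of the zeta integral (`GodementJacquet1972_gjZeta_meromorphic_holds`) through
`GodementJacquet1972_meromorphic_partialStandardL_of_gjZeta_meromorphic`.
[cite: GodementJacquet1972, Thm. 13.8] -/
theorem GodementJacquet1972_meromorphic_partialStandardL_holds :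
    GodementJacquet1972_meromorphic_partialStandardL (n := n) (K := K) (μ := μ) :=
  GodementJacquet1972_meromorphic_partialStandardL_of_gjZeta_meromorphic
    GodementJacquet1972_gjZeta_meromorphic_holds

/-- **lang.S21, partial L-functions, holds**: for every cuspidal `Π` on `GL_n(𝔸_K)`, finite `S`
containing the ramified places of `Π` and honest Satake family `α` off `S`, the partial standard
L-function `L^S(s, Π)` has meromorphic continuation to `ℂ` — the named fact
`partialStandardL_hasMeromorphicContinuation` of `AutomorphicLFunctions`, from
`GodementJacquet1972_gjZeta_meromorphic_holds` and `summable_normSq_trace_satakePow_holds` through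
`partialStandardL_hasMeromorphicContinuation_of_gjZeta_meromorphic_of_summable`.
[cite: GodementJacquet1972, Thm. 13.8 with Thm. 3.3] [cite: JacquetShalikaAJM1981, Thm. (5.3)] -/
theorem partialStandardL_hasMeromorphicContinuation_holds :
    partialStandardL_hasMeromorphicContinuation (n := n) (K := K) (μ := μ) :=
  partialStandardL_hasMeromorphicContinuation_of_gjZeta_meromorphic_of_summable
    GodementJacquet1972_gjZeta_meromorphic_holds summable_normSq_trace_satakePow_holds

/-- **lang.S21 holds: meromorphic continuation of the standard L-function of every cuspidal
automorphic representation of `GL_n(𝔸_K)`** — the named fact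
`godementJacquet_hasMeromorphicContinuation` of `AutomorphicLFunctions` (Godement–Jacquet 1972,
Thm. 13.8; Jacquet–Shalika 1981, Thm. (5.3)): some standard L-function datum `D` of `Π` (the true
Godement–Jacquet factors) has `D.L` meromorphic on `ℂ`. Composition of the tree's reduction
`godementJacquet_hasMeromorphicContinuation_of_gjZeta_meromorphic_of_summable` with the two
discharges `GodementJacquet1972_gjZeta_meromorphic_holds` (global zeta integrals, LNM 260 §§11–13)
and `summable_normSq_trace_satakePow_holds` (Jacquet–Shalika (5.3.3)–(5.3.4)).
[cite: GodementJacquet1972, Thm. 13.8] [cite: JacquetShalikaAJM1981, Thm. (5.3)] -/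
theorem godementJacquet_hasMeromorphicContinuation_holds :
    godementJacquet_hasMeromorphicContinuation (n := n) (K := K) (μ := μ) :=
  godementJacquet_hasMeromorphicContinuation_of_gjZeta_meromorphic_of_summable
    GodementJacquet1972_gjZeta_meromorphic_holds summable_normSq_trace_satakePow_holds

end Literature.NumberTheory.Automorphic

end
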